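import Summits.ResolutionOfSingularities.ResolutionOfSingularities.Theorems.EquisingularLiftEquisingularLiftNatDirectionRoundChart
import Literature.AlgebraicGeometry.HodgeTheory.RegularImmersionConormalBasis
import Literature.AlgebraicGeometry.Modules.FrameTransition
import HarnessLib

/-!
# [OURS · L1 W4.5(b) · EL♮(3) (L) brick C2, sub-brick B1c] The transition of the conormal frames of the section `Γ̃₁ ⊂ Ẽ₁` between two charts

Cell res-hironaka, LADDER-RESOLUTION rung L, slot W4.5(b), crux chain w45b: EL♮(3) = stmt-ResolutionOfSingularities-20148, brick C2 of
`Tower.hLift_of_bricks` (census `Cruxes/EquisingularLiftNatThree/Lines/C2-CENSUS-res-type-027.md`, desk ruling 2026-08-27T23:27:38Z «C2 AS TYPED»).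
Seat res-type-027 g15. `--supports stmt-ResolutionOfSingularities-20148 --as helper`. OURS; NOT a statement of any manuscript; AI-written, weaker than
expert review. Definition-free; standard axioms.

SETTING: the round `υ : G₁ ⟶ G₀` (blow-up along `Ī`), its reduced exceptional divisor `Ẽ₁` (`𝓘⟨E₁⟩ = Ī·𝒪_{G₁}`), the section `Γ̃₁`
(`𝓘⟨Γ₁⟩ = σᶜ(𝒟', 1)`), the inclusion `i₁ : Γ̃₁ ⟶ Ẽ₁`; TWO adapted affine frames `(W_x, c^x)`, `(W_y, c^y)` of `Ī` (sub-brick B1′) with chart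
ratios `T_x`, `T_y` (sub-brick B1a), and, on an affine `W″ ⊆ W_x ∩ W_y`, the RING RELATIONS `c^y₀ = a₀ c^x₀ + b₀ c^x₁` (`b₀ ∈ Ī(W″)`, adaptedness) and
`c^y₁ = m c^x₀ + v c^x₁`. Then, on an affine `O ⊆ G₁[W_x,c^x₁] ∩ G₁[W_y,c^y₁] ∩ υ⁻¹W″`:
* `chartRatio_rel_of_adapted_frames` — `(m T_x + v)·T_y = a₀ T_x + β·g_x` in `Γ(G₁, O)` (`g_x = υ^*c^x₁` regular: cancel it);
* `chartRatio_rel_on_exceptional` — on `Ẽ₁`: `(m̄ T̄_x + v̄)·T̄_y = ā₀ T̄_x`;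
* `conormal_unitSection_rel` — in the conormal bundle `𝒞_{Γ̃₁/Ẽ₁} = i₁^*𝓘` over an open `B` above `O`: `v̄|·η(s_y) = ā₀|·η(s_x)` for ideal-module
  sections `s_x ↦ T̄_x`, `s_y ↦ T̄_y` (`T̄_x T̄_y ∈ 𝓘²` dies);
* `transition_conormalFrame_mul` — for rank-one frames `κ_x`, `κ_y` of `𝒞_{Γ̃₁/Ẽ₁}` with basis sections `η(s_x)`, `η(s_y)` (sub-brick B1b):
  `T(κ_x, κ_y) · (v pulled back to Γ̃₁) = (a₀ pulled back to Γ̃₁)` — the cocycle of the conormal line bundle is `ū/v̄` (census §1).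
[cite: Hartshorne1977, II Thm. 8.24 (b), II.8 Thm. 8.17] [cite: StacksProject, Tag 0804] [folklore: relative Euler sequence on a section, chart form]
-/

set_option linter.dupNamespace false

noncomputable section

open CategoryTheory CategoryTheory.Limits AlgebraicGeometry TopologicalSpace Opposite
open Literature.AlgebraicGeometry.Resolution Literature.AlgebraicGeometry.Deformation Literature.AlgebraicGeometry.Modules
open Literature.AlgebraicGeometry.Motives Literature.AlgebraicGeometry.HodgeTheory
open AlgebraicGeometry.Scheme.IdealSheafData

namespace Summit.ResolutionOfSingularities.ResolutionOfSingularities.Cruxes.EquisingularLiftNat.Sections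


section G₁

variable {G₁ G₀ : Scheme.{0}} {υ : G₁ ⟶ G₀} {Ī : G₀.IdealSheafData}

/-- Pulling back to a principal chart and restricting to `O` is pulling back the restriction to `W″`. [folklore] -/
theorem map_appLE_blowupChart_eq (W W'' : G₀.affineOpens) (hW'' : (W'' : G₀.Opens) ≤ W) (b : Γ(G₀, (W : G₀.Opens)))
    (O : G₁.affineOpens) (hO : (O : G₁.Opens) ≤ blowupChart υ Ī W b) (hOW : (O : G₁.Opens) ≤ υ ⁻¹ᵁ (W'' : G₀.Opens))
    (s : Γ(G₀, (W : G₀.Opens))) :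
    G₁.presheaf.map (homOfLE hO).op (υ.appLE W (blowupChart υ Ī W b) (blowupChart_le_preimage υ Ī W b) s) =
      υ.appLE W'' O hOW (G₀.presheaf.map (homOfLE hW'').op s) := by
  rw [← CommRingCat.comp_apply, Scheme.Hom.appLE_map, ← CommRingCat.comp_apply, Scheme.Hom.map_appLE]

/-- **The ratio relation on `G₁`.** With `g_x = υ^*c^x₁`, `g_x T_x = υ^*c^x₀` (and the same for `y`), the ring relations
`c^y₀ = a₀ c^x₀ + b₀ c^x₁` (`b₀ ∈ Ī(W″)`), `c^y₁ = m c^x₀ + v c^x₁` give, on an affine `O` inside both charts over `W″`,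
`(m T_x + v)·T_y = a₀ T_x + β·g_x` for some `β` (`υ^*b₀ = β g_x`; the common factor `g_x` is a non-zero-divisor). [cite: StacksProject, Tag 0804] -/
theorem chartRatio_rel_of_adapted_frames (hυ : IsBlowup υ Ī) (Wx Wy W'' : G₀.affineOpens)
    (cx : Fin 2 → Γ(G₀, (Wx : G₀.Opens))) (cy : Fin 2 → Γ(G₀, (Wy : G₀.Opens)))
    (hcx1 : cx 1 ∈ Ī.ideal Wx)
    (hx'' : (W'' : G₀.Opens) ≤ Wx) (hy'' : (W'' : G₀.Opens) ≤ Wy)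
    (a₀ b₀ m v : Γ(G₀, (W'' : G₀.Opens))) (hb₀ : b₀ ∈ Ī.ideal W'')
    (hrel₀ : G₀.presheaf.map (homOfLE hy'').op (cy 0) =
      a₀ * G₀.presheaf.map (homOfLE hx'').op (cx 0) + b₀ * G₀.presheaf.map (homOfLE hx'').op (cx 1))
    (hrel₁ : G₀.presheaf.map (homOfLE hy'').op (cy 1) =
      m * G₀.presheaf.map (homOfLE hx'').op (cx 0) + v * G₀.presheaf.map (homOfLE hx'').op (cx 1))
    (Tx : Γ(G₁, blowupChart υ Ī Wx (cx 1)))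
    (hTx : υ.appLE Wx (blowupChart υ Ī Wx (cx 1)) (blowupChart_le_preimage υ Ī Wx (cx 1)) (cx 1) * Tx =
      υ.appLE Wx (blowupChart υ Ī Wx (cx 1)) (blowupChart_le_preimage υ Ī Wx (cx 1)) (cx 0))
    (Ty : Γ(G₁, blowupChart υ Ī Wy (cy 1)))
    (hTy : υ.appLE Wy (blowupChart υ Ī Wy (cy 1)) (blowupChart_le_preimage υ Ī Wy (cy 1)) (cy 1) * Ty =
      υ.appLE Wy (blowupChart υ Ī Wy (cy 1)) (blowupChart_le_preimage υ Ī Wy (cy 1)) (cy 0))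
    (O : G₁.affineOpens) (hOx : (O : G₁.Opens) ≤ blowupChart υ Ī Wx (cx 1)) (hOy : (O : G₁.Opens) ≤ blowupChart υ Ī Wy (cy 1))
    (hOW : (O : G₁.Opens) ≤ υ ⁻¹ᵁ (W'' : G₀.Opens)) :
    ∃ β : Γ(G₁, (O : G₁.Opens)),
      (υ.appLE W'' O hOW m * G₁.presheaf.map (homOfLE hOx).op Tx + υ.appLE W'' O hOW v) * G₁.presheaf.map (homOfLE hOy).op Ty =
        υ.appLE W'' O hOW a₀ * G₁.presheaf.map (homOfLE hOx).op Tx +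
          β * υ.appLE W'' O hOW (G₀.presheaf.map (homOfLE hx'').op (cx 1)) := by
  -- notation: `φ = υ♯ : Γ(W″) → Γ(O)`, `gx = υ^*c^x₁|_O`, the restricted ratios
  have hφx : ∀ s, G₁.presheaf.map (homOfLE hOx).op
      (υ.appLE Wx (blowupChart υ Ī Wx (cx 1)) (blowupChart_le_preimage υ Ī Wx (cx 1)) s) =
      υ.appLE W'' O hOW (G₀.presheaf.map (homOfLE hx'').op s) := map_appLE_blowupChart_eq Wx W'' hx'' (cx 1) O hOx hOW
  have hφy : ∀ s, G₁.presheaf.map (homOfLE hOy).op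
      (υ.appLE Wy (blowupChart υ Ī Wy (cy 1)) (blowupChart_le_preimage υ Ī Wy (cy 1)) s) =
      υ.appLE W'' O hOW (G₀.presheaf.map (homOfLE hy'').op s) := map_appLE_blowupChart_eq Wy W'' hy'' (cy 1) O hOy hOW
  -- the ratio relations restricted to `O`
  have hx : υ.appLE W'' O hOW (G₀.presheaf.map (homOfLE hx'').op (cx 1)) * G₁.presheaf.map (homOfLE hOx).op Tx =
      υ.appLE W'' O hOW (G₀.presheaf.map (homOfLE hx'').op (cx 0)) := by
    rw [← hφx, ← hφx, ← map_mul, hTx]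
  have hy : υ.appLE W'' O hOW (G₀.presheaf.map (homOfLE hy'').op (cy 1)) * G₁.presheaf.map (homOfLE hOy).op Ty =
      υ.appLE W'' O hOW (G₀.presheaf.map (homOfLE hy'').op (cy 0)) := by
    rw [← hφy, ← hφy, ← map_mul, hTy]
  -- on `O ⊆ G₁[W_x, c^x₁]`: `Ī·𝒪(O) = (gx)`, `gx` a non-zero-divisor
  obtain ⟨hle, hnzd, hideal⟩ := (hυ.isPrincipalChart_blowupChart (U := Wx) hcx1).of_le (W' := O) hOx
  have hgx : υ.appLE Wx O hle (cx 1) = υ.appLE W'' O hOW (G₀.presheaf.map (homOfLE hx'').op (cx 1)) := by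
    rw [← CommRingCat.comp_apply, Scheme.Hom.map_appLE]
  -- `υ^*b₀ = β gx`
  have hb : υ.appLE W'' O hOW b₀ ∈ Ideal.span {υ.appLE W'' O hOW (G₀.presheaf.map (homOfLE hx'').op (cx 1))} := by
    rw [← hgx, ← hideal, ideal_comap_of_le υ Ī W'' O hOW]
    exact Ideal.mem_map_of_mem _ hb₀
  obtain ⟨β, hβ⟩ := Ideal.mem_span_singleton'.mp hb
  refine ⟨β, ?_⟩
  -- cancel `gx`
  rw [hgx] at hnzd
  refine (mul_cancel_left_mem_nonZeroDivisors hnzd).mp ?_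
  have e1 : υ.appLE W'' O hOW (G₀.presheaf.map (homOfLE hx'').op (cx 1)) *
      ((υ.appLE W'' O hOW m * G₁.presheaf.map (homOfLE hOx).op Tx + υ.appLE W'' O hOW v) * G₁.presheaf.map (homOfLE hOy).op Ty) =
      υ.appLE W'' O hOW (G₀.presheaf.map (homOfLE hy'').op (cy 1)) * G₁.presheaf.map (homOfLE hOy).op Ty := by
    rw [hrel₁, map_add, map_mul, map_mul, ← hx]; ring
  have e2 : υ.appLE W'' O hOW (G₀.presheaf.map (homOfLE hx'').op (cx 1)) *
      (υ.appLE W'' O hOW a₀ * G₁.presheaf.map (homOfLE hOx).op Tx + β * υ.appLE W'' O hOW (G₀.presheaf.map (homOfLE hx'').op (cx 1))) =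
      υ.appLE W'' O hOW (G₀.presheaf.map (homOfLE hy'').op (cy 0)) := by
    rw [hrel₀, map_add, map_mul, map_mul, ← hx, hβ]; ring
  rw [e1, e2, hy]

end G₁

section Exceptional

variable {G₁ G₀ : Scheme.{0}} {υ : G₁ ⟶ G₀} {Ī : G₀.IdealSheafData}

/-- The generator `g_x|_O` of `Ī·𝒪_{G₁}` dies on the reduced exceptional divisor `Ẽ₁` (`𝓘⟨E₁⟩ = Ī·𝒪_{G₁}`). [folklore] -/
theorem redSubι_app_generator_eq_zero (E₁ : Set G₁) (hE₁ : IsClosed E₁) (hEĪ : vanishingIdeal (⟨E₁, hE₁⟩ : Closeds G₁) = Ī.comap υ)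
    (W'' : G₀.affineOpens) (O : G₁.affineOpens) (hOW : (O : G₁.Opens) ≤ υ ⁻¹ᵁ (W'' : G₀.Opens))
    (b : Γ(G₀, (W'' : G₀.Opens))) (hb : b ∈ Ī.ideal W'') :
    ((vanishingIdeal (⟨E₁, hE₁⟩ : Closeds G₁)).subschemeι).app O (υ.appLE W'' O hOW b) = 0 := by
  have hmem : υ.appLE W'' O hOW b ∈ (vanishingIdeal (⟨E₁, hE₁⟩ : Closeds G₁)).ideal O := by
    rw [hEĪ, ideal_comap_of_le υ Ī W'' O hOW]
    exact Ideal.mem_map_of_mem _ hb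
  rw [← ker_subschemeι_app] at hmem
  exact hmem

/-- **The ratio relation on the reduced exceptional divisor `Ẽ₁`**: `(m̄ T̄_x + v̄)·T̄_y = ā₀ T̄_x` (the `β g_x` term dies). [folklore] -/
theorem chartRatio_rel_on_exceptional (E₁ : Set G₁) (hE₁ : IsClosed E₁)
    (hEĪ : vanishingIdeal (⟨E₁, hE₁⟩ : Closeds G₁) = Ī.comap υ)
    (Wx W'' : G₀.affineOpens) (cx : Fin 2 → Γ(G₀, (Wx : G₀.Opens))) (hcx1 : cx 1 ∈ Ī.ideal Wx) (hx'' : (W'' : G₀.Opens) ≤ Wx)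
    (a₀ m v : Γ(G₀, (W'' : G₀.Opens))) (O : G₁.affineOpens) (hOW : (O : G₁.Opens) ≤ υ ⁻¹ᵁ (W'' : G₀.Opens))
    (tx ty β : Γ(G₁, (O : G₁.Opens)))
    (hrel : (υ.appLE W'' O hOW m * tx + υ.appLE W'' O hOW v) * ty =
      υ.appLE W'' O hOW a₀ * tx + β * υ.appLE W'' O hOW (G₀.presheaf.map (homOfLE hx'').op (cx 1))) :
    (((vanishingIdeal (⟨E₁, hE₁⟩ : Closeds G₁)).subschemeι).app O (υ.appLE W'' O hOW m) * ((vanishingIdeal (⟨E₁, hE₁⟩ : Closeds G₁)).subschemeι).app O tx +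
        ((vanishingIdeal (⟨E₁, hE₁⟩ : Closeds G₁)).subschemeι).app O (υ.appLE W'' O hOW v)) * ((vanishingIdeal (⟨E₁, hE₁⟩ : Closeds G₁)).subschemeι).app O ty =
      ((vanishingIdeal (⟨E₁, hE₁⟩ : Closeds G₁)).subschemeι).app O (υ.appLE W'' O hOW a₀) * ((vanishingIdeal (⟨E₁, hE₁⟩ : Closeds G₁)).subschemeι).app O tx := by
  have h0 : ((vanishingIdeal (⟨E₁, hE₁⟩ : Closeds G₁)).subschemeι).app O (υ.appLE W'' O hOW (G₀.presheaf.map (homOfLE hx'').op (cx 1))) = 0 :=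
    redSubι_app_generator_eq_zero E₁ hE₁ hEĪ W'' O hOW _ (by rw [← Ī.map_ideal hx'']; exact Ideal.mem_map_of_mem _ hcx1)
  have h := congrArg (((vanishingIdeal (⟨E₁, hE₁⟩ : Closeds G₁)).subschemeι).app O) hrel
  rw [map_mul, map_add, map_mul, map_add, map_mul, map_mul, h0, mul_zero, add_zero] at h
  exact h

end Exceptional

section Conormal

variable {G₁ : Scheme.{0}}

/-- Restriction of ideal-module sections commutes with `toRing`. [folklore] -/
theorem toRing_map {Y : Scheme.{0}} {J : Y.Modules} (ιJ : J ⟶ unitModule Y) {W W' : Y.Opens} (k : W' ≤ W) (a : Γ(J, W)) :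
    toRing ιJ W' (J.presheaf.map (homOfLE k).op a) = Y.presheaf.map (homOfLE k).op (toRing ιJ W a) :=
  (map_toRing ιJ (homOfLE k) a).symm

/-- `η` of a restricted section is the restricted `η`. [folklore] -/
theorem unitSectionLE_map {X Y : Scheme.{0}} (f : X ⟶ Y) (M : Y.Modules) {V V' : Y.Opens} (k : V' ≤ V) {U : X.Opens} (h : U ≤ f ⁻¹ᵁ V')
    (m : Γ(M, V)) :
    unitSectionLE f M h (M.presheaf.map (homOfLE k).op m) = unitSectionLE f M (h.trans (f.preimage_mono k)) m := by
  rw [unitSectionLE, unitSectionLE, unitSection_map, presheaf_map_map]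
  rfl

/-- **The conormal relation**: for the inclusion `i₁ : Γ̃₁ ⟶ Ẽ₁` and ideal-module sections `s_x ↦ T̄_x`, `s_y ↦ T̄_y` over an open `Oₑ` of `Ẽ₁` on which
`(m̄ T̄_x + v̄)·T̄_y = ā₀ T̄_x` holds and `T̄_x` dies on `Γ̃₁`: in `𝒞_{Γ̃₁/Ẽ₁} = i₁^*𝓘` over any `B ≤ i₁⁻¹Oₑ`,
`i₁♯(v̄)·η(s_y)|_B = i₁♯(ā₀)·η(s_x)|_B` (the term `m̄ T̄_x T̄_y ∈ 𝓘²` dies under `η`). [cite: Hartshorne1977, II.8 Thm. 8.17] [folklore] -/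
theorem conormal_unitSection_rel {Γt Et : Scheme.{0}} (i₁ : Γt ⟶ Et) (Oe : Et.Opens)
    (mb vb ab Tbx Tby : Γ(Et, Oe)) (hrel : (mb * Tbx + vb) * Tby = ab * Tbx)
    (sx sy : Γ(idealModule i₁, Oe)) (hsx : toRing (idealModuleι i₁) Oe sx = Tbx) (hsy : toRing (idealModuleι i₁) Oe sy = Tby)
    {B : Γt.Opens} (hB : B ≤ i₁ ⁻¹ᵁ Oe) (hTx : i₁.appLE Oe B hB Tbx = 0) :
    i₁.appLE Oe B hB vb • unitSectionLE i₁ (idealModule i₁) hB sy =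
      i₁.appLE Oe B hB ab • unitSectionLE i₁ (idealModule i₁) hB sx := by
  -- the identity of ideal-module sections `v̄•s_y + (m̄ T̄_x)•s_y = ā₀•s_x`, by injectivity of `𝓘 ↪ 𝒪`
  have hsec : vb • sy + (mb * Tbx) • sy = ab • sx := by
    apply kernel_ι_app_injective (structureModuleMap i₁) Oe
    change toRing (idealModuleι i₁) Oe (vb • sy + (mb * Tbx) • sy) = toRing (idealModuleι i₁) Oe (ab • sx)
    rw [toRing_add, toRing_smul, toRing_smul, toRing_smul, hsx, hsy, ← hrel]
    ring
  have h := congrArg (unitSectionLE i₁ (idealModule i₁) hB) hsec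
  rw [unitSectionLE_add, unitSectionLE_smul, unitSectionLE_smul, unitSectionLE_smul, map_mul, hTx, mul_zero, zero_smul, add_zero] at h
  exact h

/-- **The transition scalar of the conormal frames.** If `κ_x`, `κ_y` are rank-one frames of `𝒞_{Γ̃₁/Ẽ₁}` on `B_x`, `B_y` with basis sections
`η(s_x)|`, `η(s_y)|` (sub-brick B1b), then on `B ≤ B_x ∩ B_y` over `Oₑ` the transition scalar `t = T(κ_x, κ_y)₀₀` (`η(s_y)| = t·η(s_x)|`) satisfies
`t · i₁♯(v̄) = i₁♯(ā₀)`: the cocycle of the conormal line bundle of the section is `ū/v̄`. [folklore: relative Euler sequence on a section, chart form] -/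
theorem transition_conormalFrame_mul {Γt Et : Scheme.{0}} (i₁ : Γt ⟶ Et) (Oe Vx Vy : Et.Opens) (hOx : Oe ≤ Vx) (hOy : Oe ≤ Vy)
    (mb vb ab : Γ(Et, Oe)) (Tx : Γ(Et, Vx)) (Ty : Γ(Et, Vy))
    (hrel : (mb * Et.presheaf.map (homOfLE hOx).op Tx + vb) * Et.presheaf.map (homOfLE hOy).op Ty = ab * Et.presheaf.map (homOfLE hOx).op Tx)
    (sx : Γ(idealModule i₁, Vx)) (sy : Γ(idealModule i₁, Vy))
    (hsx : toRing (idealModuleι i₁) Vx sx = Tx) (hsy : toRing (idealModuleι i₁) Vy sy = Ty)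
    {Bx By B : Γt.Opens} (hBx : Bx ≤ i₁ ⁻¹ᵁ Vx) (hBy : By ≤ i₁ ⁻¹ᵁ Vy) (hBBx : B ≤ Bx) (hBBy : B ≤ By) (hB : B ≤ i₁ ⁻¹ᵁ Oe)
    (hTx : i₁.appLE Oe B hB (Et.presheaf.map (homOfLE hOx).op Tx) = 0)
    (κx : SheafOfModules.free (Fin 1) ≅ ((Scheme.Modules.pullback i₁).obj (idealModule i₁)).over Bx)
    (κy : SheafOfModules.free (Fin 1) ≅ ((Scheme.Modules.pullback i₁).obj (idealModule i₁)).over By)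
    (hκx : basisSection κx 0 = unitSectionLE i₁ (idealModule i₁) hBx sx)
    (hκy : basisSection κy 0 = unitSectionLE i₁ (idealModule i₁) hBy sy) :
    transition κx κy (homOfLE hBBx) (homOfLE hBBy) 0 0 * i₁.appLE Oe B hB vb = i₁.appLE Oe B hB ab := by
  classical
  -- the conormal relation over `B`, for the restricted sections
  have hrelB := conormal_unitSection_rel i₁ Oe mb vb ab (Et.presheaf.map (homOfLE hOx).op Tx) (Et.presheaf.map (homOfLE hOy).op Ty) hrel
    ((idealModule i₁).presheaf.map (homOfLE hOx).op sx) ((idealModule i₁).presheaf.map (homOfLE hOy).op sy)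
    (by rw [toRing_map, hsx]) (by rw [toRing_map, hsy]) hB hTx
  rw [unitSectionLE_map, unitSectionLE_map] at hrelB
  -- the basis sections restricted to `B`
  have hbx : ((Scheme.Modules.pullback i₁).obj (idealModule i₁)).presheaf.map (homOfLE hBBx).op (basisSection κx 0) =
      unitSectionLE i₁ (idealModule i₁) (hB.trans (i₁.preimage_mono hOx)) sx := by
    rw [hκx, unitSectionLE, unitSectionLE, presheaf_map_map]; rfl
  have hby : ((Scheme.Modules.pullback i₁).obj (idealModule i₁)).presheaf.map (homOfLE hBBy).op (basisSection κy 0) =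
      unitSectionLE i₁ (idealModule i₁) (hB.trans (i₁.preimage_mono hOy)) sy := by
    rw [hκy, unitSectionLE, unitSectionLE, presheaf_map_map]; rfl
  -- `η(s_y)|_B = t • η(s_x)|_B`
  have hexp := map_basisSection_eq_sum_transition κx κy (homOfLE hBBx) (homOfLE hBBy) 0
  rw [Fin.sum_univ_one, hby] at hexp
  -- compare coefficients along the basis section `b_x|_B = η(s_x)|_B`
  rw [hexp, ← hbx] at hrelB
  have hc := congrArg (fun σ => coord κx (homOfLE hBBx) σ 0) hrelB
  simp only [coord_smul, coord_map_basisSection, if_true, mul_one] at hc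
  rw [mul_comm]
  exact hc

end Conormal

end Summit.ResolutionOfSingularities.ResolutionOfSingularities.Cruxes.EquisingularLiftNat.Sections

end
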